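import Summits.NavierStokesRegularity.NavierStokesRegularity.Theorems.HodographBetchovClassBudgetsRegulariseHodograph
import Literature.Analysis.FluidPDE.EnstrophyGronwall
import Mathlib.Analysis.Calculus.BumpFunction.Convolution
import Mathlib.Analysis.Calculus.ContDiff.Convolution

/-!
# Support item `HodographBetchov.HodographConditioning` (stmt-NavierStokesRegularity-15834) —
# the null-Lagrangian identity for `C¹` fields (mollification and cutoff steps)

The route's support item HODOGRAPH CONDITIONING asks, for `u ∈ C¹(ℝ³; ℝ³)` tending to `0` at
infinity with `det ∇u ∈ L¹` and every bounded Borel `g`, that `∫ g(u(x)) det ∇u(x) dx = 0`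
(the velocity-space "hodograph" measure `u_* (det ∇u dx)` vanishes: Brouwer degree zero).

This file proves the analytic core WITHOUT degree theory or the area formula, in four steps:

* `integral_fderiv_comp_mul_det_eq_zero_of_hasCompactSupport` — `V ∈ C²` with compact support,
  `b ∈ C¹`: `∫ (∂₀ b)(V) det ∇V = 0` (the tree's divergence-theorem identity
  `ClassBudgetsRegularise.integral_fderiv_comp_mul_det_eq_zero`, the determinant being a null
  Lagrangian: `(∂₀ b)(V) det ∇V = div (b(V) ∇V₁ × ∇V₂)`);
* `integral_fderiv_comp_mul_det_eq_zero_of_contDiff_one` — the same for `V ∈ C¹` with compact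
  support, by mollification `Vₙ = ρₙ ⋆ V` (`∇Vₙ = ρₙ ⋆ ∇V → ∇V` pointwise with uniform bounds,
  dominated convergence);
* `integral_fderiv_comp_mul_det_eq_zero_of_tendsto` — `V ∈ C¹` tending to `0` at infinity and a
  weight derivative `∂₀ b` vanishing on a ball around the origin of velocity space: a smooth cutoff
  of `V` outside a large ball does not change the integrand anywhere;
* `integral_comp_mul_det_eq_zero_of_contDiff` — hence `∫ f(V) det ∇V = 0` for every smooth `f`
  vanishing near the origin (`f = ∂₀` of its line primitive, tree lemmas
  `contDiff_linePrimitive`, `fderiv_linePrimitive_apply`).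

No integrability of `det ∇V` is needed up to this point (all integrands are compactly supported).
The passage to bounded continuous and then bounded measurable weights (where `det ∇V ∈ L¹`
enters) is in `HodographBetchovHodographConditioning.lean`.

References: J. M. Ball, Arch. Ration. Mech. Anal. 63 (1977), §3 (null Lagrangians);
L. C. Evans, *Partial Differential Equations*, §8.1.4.b; I. Fonseca, W. Gangbo, *Degree Theory in
Analysis and Applications* (1995), Ch. 5 (the degree formula this replaces).
-/

noncomputable section

open MeasureTheory Set Function Filter Topology InnerProductSpace Metric
open scoped RealInnerProductSpace ContDiff ENNReal Convolution

-- the summit and its single sub-problem share the name (CONVENTIONS §1), as in every Theorems file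
set_option linter.dupNamespace false

namespace Summit.NavierStokesRegularity.NavierStokesRegularity.Theorems.HodographConditioning

open Literature.Analysis Literature.Analysis.FluidPDE Literature.Analysis.FunctionSpaces

/-! ### Step 1: `C²` fields with compact support -/

/-- For `V ∈ C²(ℝ³; ℝ³)` with compact support and `b ∈ C¹(ℝ³)`: `∫ (∂₀ b)(V x) det ∇V(x) dx = 0`
(the tree's null-Lagrangian identity; compact support supplies the boundedness and
integrability it asks for). [cite: Evans2010, §8.1.4.b (determinants are null Lagrangians)] -/
theorem integral_fderiv_comp_mul_det_eq_zero_of_hasCompactSupport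
    {V : EuclideanSpace ℝ (Fin 3) → EuclideanSpace ℝ (Fin 3)} (hV : ContDiff ℝ 2 V)
    (hVc : HasCompactSupport V) {b : EuclideanSpace ℝ (Fin 3) → ℝ} (hb : ContDiff ℝ 1 b) :
    ∫ x, fderiv ℝ b (V x) (EuclideanSpace.single 0 1) * (fderiv ℝ V x).det = 0 := by
  obtain ⟨B, hB⟩ := hV.continuous.bounded_above_of_compact_support hVc
  have hcdf : Continuous (fderiv ℝ V) := hV.continuous_fderiv (by norm_num)
  obtain ⟨K, hK⟩ := hcdf.bounded_above_of_compact_support (hVc.fderiv ℝ)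
  have hint : Integrable fun x => frobeniusNormSq (fderiv ℝ V x) := by
    refine (continuous_frobeniusNormSq_clm.comp hcdf).integrable_of_hasCompactSupport ?_
    exact (hVc.fderiv ℝ).comp_left frobeniusNormSq_zero
  exact ClassBudgetsRegularise.integral_fderiv_comp_mul_det_eq_zero hV hB hK hint hb

/-! ### Step 2: `C¹` fields with compact support (mollification) -/

/-- The convolution of a normed bump with a function bounded by `K` on the relevant ball is
bounded by `K`. [folklore] -/
theorem norm_normed_convolution_le {F : Type*} [NormedAddCommGroup F] [NormedSpace ℝ F]
    [CompleteSpace F] (φ : ContDiffBump (0 : EuclideanSpace ℝ (Fin 3)))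
    {g : EuclideanSpace ℝ (Fin 3) → F} (hg : AEStronglyMeasurable g volume)
    {x : EuclideanSpace ℝ (Fin 3)} {K : ℝ} (hK : 0 ≤ K) (hgK : ∀ y ∈ ball x φ.rOut, ‖g y‖ ≤ K) :
    ‖(φ.normed volume ⋆[ContinuousLinearMap.lsmul ℝ ℝ, volume] g) x‖ ≤ K := by
  have h := dist_convolution_le (z₀ := (0 : F)) hK φ.support_normed_eq.subset φ.nonneg_normed
    φ.integral_normed hg (fun y hy => by rw [dist_zero_right]; exact hgK y hy)
  rwa [dist_zero_right] at h

/-- For `V ∈ C¹(ℝ³; ℝ³)` with compact support and `b ∈ C¹(ℝ³)`: `∫ (∂₀ b)(V x) det ∇V(x) dx = 0`.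
Mollify: `Vₙ = ρₙ ⋆ V` is smooth with compact support, `∇Vₙ = ρₙ ⋆ ∇V`, so Step 1 applies to
`Vₙ`; `Vₙ → V` and `∇Vₙ → ∇V` pointwise with uniform bounds and supports in a fixed compact set,
and dominated convergence passes to the limit. [cite: Evans2010, §8.1.4.b and App. C.4 (mollifiers)] -/
theorem integral_fderiv_comp_mul_det_eq_zero_of_contDiff_one
    {V : EuclideanSpace ℝ (Fin 3) → EuclideanSpace ℝ (Fin 3)} (hV : ContDiff ℝ 1 V)
    (hVc : HasCompactSupport V) {b : EuclideanSpace ℝ (Fin 3) → ℝ} (hb : ContDiff ℝ 1 b) :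
    ∫ x, fderiv ℝ b (V x) (EuclideanSpace.single 0 1) * (fderiv ℝ V x).det = 0 := by
  -- the weight derivative `h = ∂₀ b` and the gradient `G = ∇V`
  have hch : Continuous fun y => fderiv ℝ b y (EuclideanSpace.single 0 1) :=
    (hb.continuous_fderiv one_ne_zero).clm_apply continuous_const
  have hcG : Continuous (fderiv ℝ V) := hV.continuous_fderiv one_ne_zero
  have hGc : HasCompactSupport (fderiv ℝ V) := hVc.fderiv ℝ
  obtain ⟨B, hB⟩ := hV.continuous.bounded_above_of_compact_support hVc
  obtain ⟨K, hK⟩ := hcG.bounded_above_of_compact_support hGc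
  have hB0 : 0 ≤ B := (norm_nonneg _).trans (hB 0)
  have hK0 : 0 ≤ K := (norm_nonneg _).trans (hK 0)
  -- a bound for the weight derivative on the closed ball containing all ranges
  obtain ⟨M, hM⟩ := (isCompact_closedBall (0 : EuclideanSpace ℝ (Fin 3)) B).exists_bound_of_continuousOn
    hch.continuousOn
  have hM0 : 0 ≤ M := (norm_nonneg _).trans (hM 0 (by simp [hB0]))
  -- the mollifiers
  set φ : ℕ → ContDiffBump (0 : EuclideanSpace ℝ (Fin 3)) := fun n =>
    ⟨1 / ((n : ℝ) + 2), 1 / ((n : ℝ) + 1), by positivity,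
      one_div_lt_one_div_of_lt (by positivity) (by linarith)⟩ with hφ
  have hφout : ∀ n, (φ n).rOut = 1 / ((n : ℝ) + 1) := fun n => rfl
  have hφle : ∀ n, (φ n).rOut ≤ 1 := fun n => by
    rw [hφout, div_le_one (by positivity)]; linarith [n.cast_nonneg (α := ℝ)]
  have hφ0 : Tendsto (fun n => (φ n).rOut) atTop (𝓝 0) := by
    simp_rw [hφout]; exact tendsto_one_div_add_atTop_nhds_zero_nat
  set W : ℕ → EuclideanSpace ℝ (Fin 3) → EuclideanSpace ℝ (Fin 3) := fun n =>
    (φ n).normed volume ⋆[ContinuousLinearMap.lsmul ℝ ℝ, volume] V with hW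
  have hVli : LocallyIntegrable V volume := hV.continuous.locallyIntegrable
  have hρli : ∀ n, LocallyIntegrable ((φ n).normed volume) volume := fun n =>
    (φ n).continuous_normed.locallyIntegrable
  -- (a) `Wₙ` is `C²` with compact support, so Step 1 applies
  have hW2 : ∀ n, ContDiff ℝ 2 (W n) := fun n =>
    (φ n).hasCompactSupport_normed.contDiff_convolution_left _ (φ n).contDiff_normed hVli
  have hWc : ∀ n, HasCompactSupport (W n) := fun n =>
    (φ n).hasCompactSupport_normed.convolution _ hVc
  have hzero : ∀ n, ∫ x, fderiv ℝ b (W n x) (EuclideanSpace.single 0 1) * (fderiv ℝ (W n) x).det = 0 :=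
    fun n => integral_fderiv_comp_mul_det_eq_zero_of_hasCompactSupport (hW2 n) (hWc n) hb
  -- (b) `∇Wₙ = ρₙ ⋆ ∇V`
  have hderiv : ∀ n x, fderiv ℝ (W n) x =
      ((φ n).normed volume ⋆[ContinuousLinearMap.lsmul ℝ ℝ, volume] fderiv ℝ V) x := by
    intro n x
    rw [(hVc.hasFDerivAt_convolution_right (ContinuousLinearMap.lsmul ℝ ℝ) (hρli n) hV x).fderiv]
    simp only [convolution_def]
    congr 1
  -- (c) uniform bounds: `‖Wₙ x‖ ≤ B`, `‖∇Wₙ x‖ ≤ K`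
  have hWB : ∀ n x, ‖W n x‖ ≤ B := fun n x =>
    norm_normed_convolution_le (φ n) hV.continuous.aestronglyMeasurable hB0 (fun y _ => hB y)
  have hWK : ∀ n x, ‖fderiv ℝ (W n) x‖ ≤ K := fun n x => by
    rw [hderiv]
    exact norm_normed_convolution_le (φ n) hcG.aestronglyMeasurable hK0 (fun y _ => hK y)
  -- (d) `∇Wₙ` vanishes off the compact set `K' = cthickening 1 (tsupport V)`
  set K' : Set (EuclideanSpace ℝ (Fin 3)) := cthickening 1 (tsupport V) with hK'
  have hK'c : IsCompact K' := hVc.isCompact.cthickening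
  have hWoff : ∀ n, ∀ x ∉ K', fderiv ℝ (W n) x = 0 := by
    intro n x hx
    rw [hderiv]
    have h := norm_normed_convolution_le (φ n) hcG.aestronglyMeasurable le_rfl (K := 0) (x := x)
      (fun y hy => ?_)
    · exact norm_le_zero_iff.1 h
    · -- `y ∉ tsupport V`, else `x` would be `1`-close to `tsupport V`
      have hy' : y ∉ tsupport V := by
        intro hyV
        apply hx
        rw [hK']
        refine Metric.mem_cthickening_of_dist_le x y 1 (tsupport V) hyV ?_
        rw [dist_comm]; exact (le_of_lt (mem_ball.1 hy)).trans (hφle n)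
      have : fderiv ℝ V y = 0 := by
        by_contra hne
        exact hy' (support_fderiv_subset ℝ (Function.mem_support.2 hne))
      rw [this, norm_zero]
  -- (e) the integrands, their domination and their pointwise limit
  set Fs : ℕ → EuclideanSpace ℝ (Fin 3) → ℝ := fun n x =>
    fderiv ℝ b (W n x) (EuclideanSpace.single 0 1) * (fderiv ℝ (W n) x).det with hFs
  have hmeas : ∀ n, AEStronglyMeasurable (Fs n) volume := fun n =>
    ((hch.comp (hW2 n).continuous).mul
      (ContinuousLinearMap.continuous_det.comp ((hW2 n).continuous_fderiv (by norm_num)))).aestronglyMeasurable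
  set C : ℝ := M * ((1 / 2) * K * (3 * K ^ 2)) with hC
  have hbound : ∀ n, ∀ᵐ x ∂volume, ‖Fs n x‖ ≤ K'.indicator (fun _ => C) x := by
    intro n
    refine Eventually.of_forall fun x => ?_
    by_cases hx : x ∈ K'
    · rw [indicator_of_mem hx, hFs]
      dsimp only
      rw [norm_mul, Real.norm_eq_abs ((fderiv ℝ (W n) x).det)]
      have h1 : ‖fderiv ℝ b (W n x) (EuclideanSpace.single 0 1)‖ ≤ M :=
        hM _ (mem_closedBall_zero_iff.2 (hWB n x))
      have hdW : DifferentiableAt ℝ (W n) x := ((hW2 n).differentiable (by norm_num)) x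
      have h2 : |(fderiv ℝ (W n) x).det| ≤ (1 / 2) * K * (3 * K ^ 2) := by
        calc |(fderiv ℝ (W n) x).det|
            ≤ (1 / 2) * ‖fderiv ℝ (W n) x‖ * frobeniusNormSq (fderiv ℝ (W n) x) :=
              ClassBudgetsRegularise.abs_det_fderiv_le hdW
          _ ≤ (1 / 2) * K * (3 * K ^ 2) := by
              have hf1 : frobeniusNormSq (fderiv ℝ (W n) x) ≤ 3 * ‖fderiv ℝ (W n) x‖ ^ 2 :=
                frobeniusNormSq_le_three_mul _
              have hf2 : 3 * ‖fderiv ℝ (W n) x‖ ^ 2 ≤ 3 * K ^ 2 := by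
                have := hWK n x
                nlinarith [norm_nonneg (fderiv ℝ (W n) x)]
              have hn1 : 0 ≤ frobeniusNormSq (fderiv ℝ (W n) x) := frobeniusNormSq_nonneg _
              calc (1 / 2) * ‖fderiv ℝ (W n) x‖ * frobeniusNormSq (fderiv ℝ (W n) x)
                  ≤ (1 / 2) * K * frobeniusNormSq (fderiv ℝ (W n) x) := by
                    gcongr; exact hWK n x
                _ ≤ (1 / 2) * K * (3 * K ^ 2) := by
                    gcongr
                    exact hf1.trans hf2
      exact mul_le_mul h1 h2 (abs_nonneg _) hM0
    · rw [indicator_of_notMem hx, hFs]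
      dsimp only
      have hdet0 : (0 : EuclideanSpace ℝ (Fin 3) →L[ℝ] EuclideanSpace ℝ (Fin 3)).det = 0 := by
        rw [ContinuousLinearMap.det, ContinuousLinearMap.toLinearMap_zero]
        exact LinearMap.det_zero' (EuclideanSpace.basisFun (Fin 3) ℝ).toBasis
      rw [hWoff n x hx, hdet0, mul_zero, norm_zero]
  have hbound_int : Integrable (K'.indicator fun _ => C) volume :=
    (integrableOn_const (hs := hK'c.measure_lt_top.ne)).integrable_indicator hK'c.measurableSet
  have hlim : ∀ᵐ x ∂volume, Tendsto (fun n => Fs n x) atTop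
      (𝓝 (fderiv ℝ b (V x) (EuclideanSpace.single 0 1) * (fderiv ℝ V x).det)) := by
    refine Eventually.of_forall fun x => ?_
    have h1 : Tendsto (fun n => W n x) atTop (𝓝 (V x)) :=
      ContDiffBump.convolution_tendsto_right_of_continuous hφ0 hV.continuous x
    have h2 : Tendsto (fun n => fderiv ℝ (W n) x) atTop (𝓝 (fderiv ℝ V x)) := by
      simp_rw [hderiv]
      exact ContDiffBump.convolution_tendsto_right_of_continuous hφ0 hcG x
    exact ((hch.tendsto _).comp h1).mul ((ContinuousLinearMap.continuous_det.tendsto _).comp h2)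
  have hDCT := tendsto_integral_of_dominated_convergence _ hmeas hbound_int hbound hlim
  have h0 : Tendsto (fun n => ∫ x, Fs n x) atTop (𝓝 0) := by
    simp_rw [hFs, hzero]; exact tendsto_const_nhds
  exact tendsto_nhds_unique hDCT h0

/-! ### Step 3: `C¹` fields tending to zero at infinity (cutoff) -/

/-- For `V ∈ C¹(ℝ³; ℝ³)` tending to `0` at infinity and `b ∈ C¹(ℝ³)` whose derivative `∂₀ b`
vanishes on a ball around the origin of velocity space: `∫ (∂₀ b)(V x) det ∇V(x) dx = 0`.
Cut `V` off smoothly outside a ball so large that `‖V‖` is below the vanishing radius there: the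
integrand is unchanged at every point, and Step 2 applies to the cutoff field. [cite: Evans2010, §8.1.4.b] -/
theorem integral_fderiv_comp_mul_det_eq_zero_of_tendsto
    {V : EuclideanSpace ℝ (Fin 3) → EuclideanSpace ℝ (Fin 3)} (hV : ContDiff ℝ 1 V)
    (h0 : Tendsto V (cocompact (EuclideanSpace ℝ (Fin 3))) (𝓝 0))
    {b : EuclideanSpace ℝ (Fin 3) → ℝ} (hb : ContDiff ℝ 1 b) {a : ℝ} (ha : 0 < a)
    (hba : ∀ y ∈ ball (0 : EuclideanSpace ℝ (Fin 3)) a, fderiv ℝ b y (EuclideanSpace.single 0 1) = 0) :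
    ∫ x, fderiv ℝ b (V x) (EuclideanSpace.single 0 1) * (fderiv ℝ V x).det = 0 := by
  -- a radius `R` beyond which `‖V‖ < a`
  have hev : ∀ᶠ x in cocompact (EuclideanSpace ℝ (Fin 3)), V x ∈ ball (0 : EuclideanSpace ℝ (Fin 3)) a :=
    h0.eventually_mem (ball_mem_nhds 0 ha)
  obtain ⟨t, ht, htV⟩ := mem_cocompact.1 hev
  obtain ⟨R₀, hR₀⟩ := ht.isBounded.subset_closedBall 0
  set R : ℝ := max R₀ 0 with hR
  have hR0 : 0 ≤ R := le_max_right _ _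
  have hfar : ∀ x : EuclideanSpace ℝ (Fin 3), R < ‖x‖ → ‖V x‖ < a := by
    intro x hx
    have hxt : x ∉ t := fun hxt => by
      have := mem_closedBall_zero_iff.1 (hR₀ hxt)
      linarith [le_max_left R₀ 0]
    simpa using htV hxt
  -- the cutoff
  set χ : ContDiffBump (0 : EuclideanSpace ℝ (Fin 3)) := ⟨R + 1, R + 2, by linarith, by linarith⟩ with hχ
  set U : EuclideanSpace ℝ (Fin 3) → EuclideanSpace ℝ (Fin 3) := fun x => χ x • V x with hU
  have hU1 : ContDiff ℝ 1 U := χ.contDiff.smul hV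
  have hUc : HasCompactSupport U := χ.hasCompactSupport.smul_right
  have hzero := integral_fderiv_comp_mul_det_eq_zero_of_contDiff_one hU1 hUc hb
  -- the integrands agree everywhere
  have heq : ∀ x, fderiv ℝ b (V x) (EuclideanSpace.single 0 1) * (fderiv ℝ V x).det =
      fderiv ℝ b (U x) (EuclideanSpace.single 0 1) * (fderiv ℝ U x).det := by
    intro x
    by_cases hx : ‖x‖ < R + 1
    · -- inside: `U = V` near `x`
      have hloc : U =ᶠ[𝓝 x] V := by
        filter_upwards [isOpen_ball.mem_nhds (mem_ball_zero_iff.2 hx)] with y hy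
        rw [hU]; dsimp only
        rw [χ.one_of_mem_closedBall (ball_subset_closedBall hy), one_smul]
      rw [hloc.fderiv_eq, hloc.self_of_nhds]
    · -- outside: both weights vanish
      push Not at hx
      have hVx : ‖V x‖ < a := hfar x (by linarith)
      have hUx : ‖U x‖ < a := by
        rw [hU]; dsimp only
        rw [norm_smul, Real.norm_eq_abs, abs_of_nonneg χ.nonneg]
        exact lt_of_le_of_lt (mul_le_of_le_one_left (norm_nonneg _) χ.le_one) hVx
      rw [hba _ (mem_ball_zero_iff.2 hVx), hba _ (mem_ball_zero_iff.2 hUx), zero_mul, zero_mul]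
  simp_rw [heq]
  exact hzero

/-! ### Step 4: smooth weights vanishing near the origin -/

/-- For `V ∈ C¹(ℝ³; ℝ³)` tending to `0` at infinity and every smooth `f : ℝ³ → ℝ` vanishing on a
ball around the origin of velocity space: `∫ f(V x) det ∇V(x) dx = 0` — Step 3 with `b` the line
primitive of `f` along the first velocity axis (`∂₀ b = f`). [cite: Evans2010, §8.1.4.b] -/
theorem integral_comp_mul_det_eq_zero_of_contDiff
    {V : EuclideanSpace ℝ (Fin 3) → EuclideanSpace ℝ (Fin 3)} (hV : ContDiff ℝ 1 V)
    (h0 : Tendsto V (cocompact (EuclideanSpace ℝ (Fin 3))) (𝓝 0))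
    {f : EuclideanSpace ℝ (Fin 3) → ℝ} (hf : ContDiff ℝ ∞ f) {a : ℝ} (ha : 0 < a)
    (hfa : ∀ y ∈ ball (0 : EuclideanSpace ℝ (Fin 3)) a, f y = 0) :
    ∫ x, f (V x) * (fderiv ℝ V x).det = 0 := by
  have hb := ClassBudgetsRegularise.contDiff_linePrimitive hf
  have h := integral_fderiv_comp_mul_det_eq_zero_of_tendsto hV h0 hb ha (fun y hy => by
    rw [ClassBudgetsRegularise.fderiv_linePrimitive_apply hf]; exact hfa y hy)
  simpa only [ClassBudgetsRegularise.fderiv_linePrimitive_apply hf] using h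

end Summit.NavierStokesRegularity.NavierStokesRegularity.Theorems.HodographConditioning

end
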